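import Summits.Ventures.CertifiedQuantumChemistry.Rows.SingletRows
import Summits.Ventures.CertifiedQuantumChemistry.Rows.APosterioriLowerBoundConditions
import Literature.MathematicalPhysics.QuantumChemistry.DualConeFamilySum
import Literature.MathematicalPhysics.QuantumChemistry.DoubletRankTwoNullity
import HarnessLib

/-!
# Ventures/CertifiedQuantumChemistry — Rows/SpinClassRows.lean: rows for the SPIN CLASS `S = M` of an
# ARBITRARY sector `(a, b)` (doublets, triplets, …) and their soundness for an arbitrary necessary
# condition set (the `Ŝ_+` ladder that turns them into SECTOR rows: `Rows/SpinClassLadderRows.lean`)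

HONEST FRAMING (verbatim): certified bounds for a stated model Hamiltonian in a stated basis; not a
claim about the real molecule or material beyond that model.

Typer seat chem-type-07 (I-TYPE slot 07 = SDP weak-duality certificate soundness for an arbitrary
condition set), zero compute, nothing landed is touched; PROVED glue (0 sorry, no claim node, nothing here
asserts any bound) plus five small DEFINITIONS that extend the venture's singlet row vocabulary
(`Statement.lean`: `singletSector k n`, `Model.singletEnergy F n`, `SingletLowerRow F n lo`, … — the
`S = M = 0` class of the balanced sector `(n, n)`) to the spin class `S = M = (a − b)/2` of ANY sector
`(a, b)`, `b ≤ a`: `spinClassSector k a b` (the `(a, b)` sector intersected with `ker Ŝ_+`, literally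
`singletSector k n` at `a = b = n`), `Model.spinClassEnergy F a b = E₀(H_F; N_α = a, N_β = b, S = M)`,
`SpinClassLowerRow / SpinClassUpperRow / SpinClassBracket F a b …` (range `b ≤ a ≤ k` carried by the row).

WHY (cell chem-oracle, 2026-08-30): the RANK-1 «relaxation repair» byte K14-PIN-R1 (chem-k14-instr-1
INSTRUMENT-SPEC-v1 §1, PREREG filed STATUS 2026-08-30T20:56:44Z; chair composition A517/A518; director-chem
WORD #41) appends to the boxed `DQGT1T2′` relaxation of the DOUBLET sector `(10, 9)` of T01a
`[Ni(N₂)]⁺` (`Hamiltonians/NiN2pTzdkA.lean`) two families of EQUALITY rows that hold for a state `ψ` of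
that sector ONLY IF `Ŝ_+ψ = 0` (F2b = the maximal-spin-projection «`Ŝ_+`-killer» rows; Q2 = Wigner–Eckart
rank-2 nullity rows): its certified `L′` therefore bounds `E₀(H_F; N = 19, S = M = ½)` — the lowest
energy on `(10,9)-sector ⊓ ker Ŝ_+` — and bounds the SECTOR energy `E(10, 9)` only under the spec's leg
P6 «the (10,9) ground multiplet is `S = ½`» (every letter carries «| P6: … UNCERTIFIED»). The Literature
side of this reading exists for every `(a, b)` (`SpinClassNecessaryConditions.lean`:
`IsNecessaryInSpinClass a b C`, `le_minEnergyOn_spinClass_of_forall_necessary`, the dual-cone forms of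
`DualConeFamilySum.lean`); the ROW side existed only at `a = b` (`Rows/SingletNecessaryConditionLowerRows`,
`Rows/SingletVersusSector`, `Rows/OpaqueNodes`). This file supplies the `a ≠ b` row side, so that a tabled
RANK-1 `L′` has a kernel reading that says exactly WHICH quantity it bounds without P6 and what a
certified P6 leg buys:

* §0 the definitions and their bookkeeping (`spinClassSector_self`, `Model.spinClassEnergy_self`,
  `spinClassLowerRow_self_iff` — at `a = b` these ARE the singlet rows; `.range/.le/.mono`).
* §1 SOUNDNESS for an arbitrary class-necessary condition set: `spinClassLowerRow_of_forall_necessary`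
  («`lo` below the energy functional on the feasible set of ANY `IsNecessaryInSpinClass a b C` ⇒
  `SpinClassLowerRow F a b lo`», one line over `le_minEnergyOn_spinClass_of_forall_necessary`) and its
  exact dual-cone form `spinClassLowerRow_of_dualCone_certificate` (Cancès–Stoltz–Lewin eqs. (8)–(10)
  with the spin constraint «taken into account»); the F2b family packaged as a class-necessary condition
  (`isNecessaryInSpinClass_maximalProjection` — `Σ_r G_{m,(r↓,r↑)} = 0` for every row index `m`, the
  `G`-matrix form in which the file carries them; the state-level fact `⟨ψ| a†_i a_j Ŝ_+ |ψ⟩ = 0` is the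
  E4a row of `Rows/MaximalSpinProjectionRows.lean` §1 — `sum_particleHoleRDM_spinPlus_eq_zero`, re-derived
  here in three lines to keep this file's import closure small), and the reading of a
  `DQGT1T2′ + F2b` certificate `spinClassLowerRow_of_forall_isDQGT1T2PrimeFeasibleSector_maximalProjection`
  (the K14-PIN-R1 ARM-B shape) and of a `DQGT1T2′ + F2b + Q2` certificate on a doublet sector
  `spinClassLowerRow_of_forall_isDQGT1T2PrimeFeasibleSector_maximalProjection_rankTwoNullity` (the
  ARM-A shape; the Q2 family's class-necessity is the Literature fact
  `isNecessaryInSpinClass_rankTwoNullity` of `DoubletRankTwoNullity.lean`).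
* The relation to the SECTOR rows — `E(a, b) ≤ E₀(a, b, S = M)`, the ladder identity
  `E(a, b+1) = min (E₀(a, b+1, S = M), E(a+1, b))`, and the row readings (class `L` + next-sector `L` ⇒
  sector `L`; the certified-`S = M` readings under a one-step gap = the spec's leg P6; the opposite reading =
  tripwire T7) — is the companion file `Rows/SpinClassLadderRows.lean` (split for the 400-line rule).
Nothing in this file is specific to T01a; no row of CERTIFIED-CHEM.md uses it today. References:
D. A. Mazziotti, Adv. Chem. Phys. 134 (2007) ch. 3 §II.F.1 eqs. (96)–(98) (`S`-representability at
`S = M`); E. Cancès, G. Stoltz, M. Lewin, J. Chem. Phys. 125 (2006) 064101 §3 eqs. (7)–(10); M. Nakata et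
al., J. Chem. Phys. 128 (2008) 164113 §II (the `DQGT1T2′` conditions); E. H. Lieb, PRL 62 (1989) 1201,
proof of Thm 1 (sectors).
WHAT THIS IS NOT: not a certificate, not a bound on any model, not a statement about the real ion; the
class rows are a DIFFERENT quantity from the sector rows and are never silently identified with them —
the companion file states the certified legs under which they coincide.
-/

noncomputable section

namespace Summit.Ventures.CertifiedQuantumChemistry

open Matrix Finset
open Literature.MathematicalPhysics.QuantumLattice Literature.MathematicalPhysics.QuantumChemistry
open scoped ComplexOrder

/-! ## §0 The spin class `S = M` of the sector `(a, b)`: subspace, quantity, rows -/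

variable {k : ℕ}

/-- The SPIN-CLASS subspace of the `(N_α, N_β) = (a, b)` sector of a `k`-orbital model: the sector
(`N̂ = a + b`, `Ŝ_z = (a − b)/2`, same arguments as `Model.energy F a b`) intersected with `ker Ŝ_+` — the
highest-weight vectors of weight `M = (a − b)/2`, i.e. (by `Ŝ² = Ŝ_−Ŝ_+ + Ŝ_z(Ŝ_z + 1)`) the sector's
states of total spin EXACTLY `S = M` (Mazziotti 2007 §II.F.1 eqs. (96)–(97), `⟨Ŝ²⟩ = S(S+1)` with
`Ŝ² = Ŝ_z + Ŝ_z² + Ŝ_−Ŝ_+`; the cell's instance row `tr(ρ Ŝ_−Ŝ_+) = S(S+1) − M(M+1) = 0`). For `a < b`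
(`M < 0`) the subspace is `⊥` (no highest-weight vector has negative weight); the physical range `b ≤ a ≤ k`
is carried by the rows. At `a = b = n` this is LITERALLY `singletSector k n` (`spinClassSector_self`).
[cite: Mazziotti2007RDMChapter, §II.F.1 eqs. (96)-(98)] -/
def spinClassSector (k a b : ℕ) : Submodule ℂ (Fock (Orb (Fin k))) :=
  szSector (a + b) (((a : ℝ) - b) / 2) ⊓
    LinearMap.ker (Matrix.toLin' (spinPlus : Matrix (Finset (Orb (Fin k))) (Finset (Orb (Fin k))) ℂ))

/-- Membership in the spin-class subspace: in the `(a, b)` sector and annihilated by `Ŝ_+`. -/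
theorem mem_spinClassSector_iff {a b : ℕ} (ψ : Fock (Orb (Fin k))) :
    ψ ∈ spinClassSector k a b ↔ IsInSector a b ψ ∧ spinPlus *ᵥ ψ = 0 :=
  mem_szSector_inf_ker_spinPlus_iff ψ

/-- At `a = b = n` the spin-class subspace IS the venture's singlet subspace (definitionally). -/
theorem spinClassSector_self (k n : ℕ) : spinClassSector k n n = singletSector k n := rfl

/-- THE SPIN-CLASS QUANTITY. `Model.spinClassEnergy F a b = E₀(H_F; N_α = a, N_β = b, S = M = (a − b)/2)`:
the lowest energy of the model Hamiltonian on the spin-class subspace of the `(a, b)` sector (the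
`Matrix.minEnergyOn` of `spinClassSector k a b`; the quantity an `S`-constrained v2RDM certificate of the
cell's instance format bounds from below, «`bound ≤ E₀(H_F; N_α, N_β, S)`»). Physical range `b ≤ a ≤ k`;
outside it the subspace is `⊥` and the value is the junk `sInf ∅ = 0` (no row is stated there).
[cite: Mazziotti2007RDMChapter, §II.F.1 eqs. (96)-(98)] -/
def Model.spinClassEnergy (F : Model k) (a b : ℕ) : ℝ :=
  F.hamiltonian.minEnergyOn (spinClassSector k a b)

/-- At `a = b = n` the spin-class quantity IS `Model.singletEnergy F n` (definitionally). -/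
theorem Model.spinClassEnergy_self (F : Model k) (n : ℕ) : F.spinClassEnergy n n = F.singletEnergy n :=
  rfl

/-- CERTIFIED SPIN-CLASS LOWER ROW: `b ≤ a ≤ k` and `lo ≤ E₀(H_F; N_α = a, N_β = b, S = M)` — the row
predicate for the cell's `S`-constrained certificates («`bound ≤ E₀(H_F; N_α, N_β, S)`», Mazziotti's
`S`-representable class at `S = M`). [cite: Mazziotti2007RDMChapter, §II.F.1 eqs. (96)-(98)] -/
def SpinClassLowerRow (F : Model k) (a b : ℕ) (lo : ℚ) : Prop :=
  b ≤ a ∧ a ≤ k ∧ ((lo : ℚ) : ℝ) ≤ F.spinClassEnergy a b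

/-- CERTIFIED SPIN-CLASS UPPER ROW: `b ≤ a ≤ k` and `E₀(H_F; N_α = a, N_β = b, S = M) ≤ hi` (a trial
state of total spin exactly `S = M`). [cite: Mazziotti2007RDMChapter, §II.F.1 eqs. (96)-(98)] -/
def SpinClassUpperRow (F : Model k) (a b : ℕ) (hi : ℚ) : Prop :=
  b ≤ a ∧ a ≤ k ∧ F.spinClassEnergy a b ≤ ((hi : ℚ) : ℝ)

/-- A two-sided spin-class row. [cite: Mazziotti2007RDMChapter, §II.F.1 eqs. (96)-(98)] -/
def SpinClassBracket (F : Model k) (a b : ℕ) (lo hi : ℚ) : Prop :=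
  SpinClassLowerRow F a b lo ∧ SpinClassUpperRow F a b hi

/-- A spin-class lower row carries its range `b ≤ a ≤ k`. -/
theorem SpinClassLowerRow.range {F : Model k} {a b : ℕ} {lo : ℚ} (h : SpinClassLowerRow F a b lo) :
    b ≤ a ∧ a ≤ k :=
  ⟨h.1, h.2.1⟩

/-- The inequality of a spin-class lower row. -/
theorem SpinClassLowerRow.le {F : Model k} {a b : ℕ} {lo : ℚ} (h : SpinClassLowerRow F a b lo) :
    ((lo : ℚ) : ℝ) ≤ F.spinClassEnergy a b :=
  h.2.2

/-- A spin-class upper row carries its range `b ≤ a ≤ k`. -/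
theorem SpinClassUpperRow.range {F : Model k} {a b : ℕ} {hi : ℚ} (h : SpinClassUpperRow F a b hi) :
    b ≤ a ∧ a ≤ k :=
  ⟨h.1, h.2.1⟩

/-- The inequality of a spin-class upper row. -/
theorem SpinClassUpperRow.le {F : Model k} {a b : ℕ} {hi : ℚ} (h : SpinClassUpperRow F a b hi) :
    F.spinClassEnergy a b ≤ ((hi : ℚ) : ℝ) :=
  h.2.2

/-- Weakening a spin-class lower row. -/
theorem SpinClassLowerRow.mono {F : Model k} {a b : ℕ} {lo lo' : ℚ} (h : SpinClassLowerRow F a b lo)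
    (hle : lo' ≤ lo) : SpinClassLowerRow F a b lo' :=
  ⟨h.1, h.2.1, le_trans (by exact_mod_cast hle) h.le⟩

/-- Weakening a spin-class upper row. -/
theorem SpinClassUpperRow.mono {F : Model k} {a b : ℕ} {hi hi' : ℚ} (h : SpinClassUpperRow F a b hi)
    (hle : hi ≤ hi') : SpinClassUpperRow F a b hi' :=
  ⟨h.1, h.2.1, h.le.trans (by exact_mod_cast hle)⟩

/-- The two ends of a spin-class bracket are ordered. -/
theorem SpinClassBracket.lo_le_hi {F : Model k} {a b : ℕ} {lo hi : ℚ} (h : SpinClassBracket F a b lo hi) :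
    lo ≤ hi := by
  exact_mod_cast h.1.le.trans h.2.le

/-- **At `a = b` a spin-class lower row IS a singlet lower row** (same quantity, same range). -/
theorem spinClassLowerRow_self_iff {F : Model k} {n : ℕ} {lo : ℚ} :
    SpinClassLowerRow F n n lo ↔ SingletLowerRow F n lo := by
  simp only [SpinClassLowerRow, SingletLowerRow, le_refl, true_and, Model.spinClassEnergy_self]

/-- **At `a = b` a spin-class upper row IS a singlet upper row.** -/
theorem spinClassUpperRow_self_iff {F : Model k} {n : ℕ} {hi : ℚ} :
    SpinClassUpperRow F n n hi ↔ SingletUpperRow F n hi := by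
  simp only [SpinClassUpperRow, SingletUpperRow, le_refl, true_and, Model.spinClassEnergy_self]

/-- A singlet lower row as a spin-class lower row at `(n, n)`. -/
theorem SingletLowerRow.spinClass {F : Model k} {n : ℕ} {lo : ℚ} (h : SingletLowerRow F n lo) :
    SpinClassLowerRow F n n lo :=
  spinClassLowerRow_self_iff.2 h

/-- A singlet upper row as a spin-class upper row at `(n, n)`. -/
theorem SingletUpperRow.spinClass {F : Model k} {n : ℕ} {hi : ℚ} (h : SingletUpperRow F n hi) :
    SpinClassUpperRow F n n hi :=
  spinClassUpperRow_self_iff.2 h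

/-! ## §1 Soundness for an ARBITRARY class-necessary condition set; the F2b family -/

section Necessary

variable {Λ : Type*} [LinearOrder Λ] [Fintype Λ]

/-- E4a at state level (re-derivation of `Rows/MaximalSpinProjectionRows.lean`
`sum_particleHoleRDM_spinPlus_eq_zero`, kept private so as not to import that file's heavy closure):
`Σ_r ²G^{(i,j)}_{(r↓,r↑)} = ⟨ψ| a†_i a_j Ŝ_+ |ψ⟩ = 0` for a vector annihilated by `Ŝ_+`. -/
private theorem sum_particleHoleRDM_downUp_eq_zero {ψ : Fock (Orb Λ)} (hP : spinPlus *ᵥ ψ = 0)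
    (i j : Orb Λ) : ∑ r : Λ, particleHoleRDM ψ (i, j) (orb r 1, orb r 0) = 0 := by
  calc ∑ r : Λ, particleHoleRDM ψ (i, j) (orb r 1, orb r 0)
      = star ψ ⬝ᵥ (creation i * annihilation j * spinPlus) *ᵥ ψ := by
        simp only [particleHoleRDM, spinPlus, Finset.mul_sum, Matrix.sum_mulVec, dotProduct_sum,
          Matrix.mul_assoc]
    _ = 0 := by rw [← mulVec_mulVec, hP, mulVec_zero, dotProduct_zero]

/-- **The maximal-spin-projection rows (F2b, `G`-matrix form) are class-necessary in EVERY sector**: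
for each row index `m` of the `G`-map, `Σ_r G_{m,(r↓,r↑)}(γ, Γ) = 0` holds at the RDM pair of every unit
vector of the `(a, b)` sector annihilated by `Ŝ_+` (`⟨ψ| a†_i a_j Ŝ_+ |ψ⟩ = 0`; the cell's FORMAT-qcl1 §5
rows E4a; Fosso-Tande–Nguyen–Gidofalvi–DePrince 2016 «maximal spin projection» constraints; K14-PIN-R1's
F2b family `(G·v)_i = 0`, `v = Σ_p e_(pα,pβ)`). The state-level fact is the E4a row of
`Rows/MaximalSpinProjectionRows.lean` §1 (`sum_particleHoleRDM_spinPlus_eq_zero`) + `gMap_rdm`.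
[cite: Mazziotti2007RDMChapter, §II.F.1 eqs. (96)-(98)] -/
theorem isNecessaryInSpinClass_maximalProjection (a b : ℕ) :
    IsNecessaryInSpinClass (Λ := Λ) a b fun γ Γ =>
      ∀ m : Orb Λ × Orb Λ, ∑ r : Λ, gMap γ Γ m (orb r 1, orb r 0) = 0 := by
  intro ψ _ hP _ m
  rw [gMap_rdm]
  exact sum_particleHoleRDM_downUp_eq_zero hP m.1 m.2

/-- Instance: **sector `DQGT1T2′` + the maximal-projection rows** is class-necessary at `(a, b)` — the
feasible set of a K14-PIN-R1 ARM-B certificate (`DQGT1T2′` of the sector with the F2b rows appended).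
[cite: NakataEtAl2008, §II.A-C] -/
theorem isNecessaryInSpinClass_isDQGT1T2PrimeFeasibleSector_maximalProjection (a b : ℕ) :
    IsNecessaryInSpinClass (Λ := Λ) a b fun γ Γ => IsDQGT1T2PrimeFeasibleSector a b γ Γ ∧
      ∀ m : Orb Λ × Orb Λ, ∑ r : Λ, gMap γ Γ m (orb r 1, orb r 0) = 0 :=
  (isNecessaryInSector_isDQGT1T2PrimeFeasibleSector a b).isNecessaryInSpinClass.and
    (isNecessaryInSpinClass_maximalProjection a b)

/-- Instance (doublet sectors): **sector `DQGT1T2′` + the maximal-projection rows + the rank-2 nullity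
rows** is necessary for the spin class of `(b+1, b)` (`S = M = ½`) — the feasible set of a K14-PIN-R1
ARM-A certificate (`DQGT1T2′` with the F2b AND Q2 families appended; the Q2 necessity is
`isNecessaryInSpinClass_rankTwoNullity`, `Literature/…/DoubletRankTwoNullity.lean`).
[cite: NakataEtAl2008, §II.A-C] -/
theorem isNecessaryInSpinClass_isDQGT1T2PrimeFeasibleSector_maximalProjection_rankTwoNullity (b : ℕ) :
    IsNecessaryInSpinClass (Λ := Λ) (b + 1) b fun γ Γ => IsDQGT1T2PrimeFeasibleSector (b + 1) b γ Γ ∧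
      (∀ m : Orb Λ × Orb Λ, ∑ r : Λ, gMap γ Γ m (orb r 1, orb r 0) = 0) ∧
      ∀ p q r s : Λ, Γ (orb p 0, orb q 0) (orb r 0, orb s 0) + Γ (orb p 1, orb q 1) (orb r 1, orb s 1) -
        Γ (orb p 0, orb q 1) (orb r 0, orb s 1) - Γ (orb p 0, orb q 1) (orb r 1, orb s 0) -
        Γ (orb p 1, orb q 0) (orb r 0, orb s 1) - Γ (orb p 1, orb q 0) (orb r 1, orb s 0) = 0 :=
  (isNecessaryInSector_isDQGT1T2PrimeFeasibleSector (b + 1) b).isNecessaryInSpinClass.and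
    ((isNecessaryInSpinClass_maximalProjection (b + 1) b).and (isNecessaryInSpinClass_rankTwoNullity b))

end Necessary

/-- **SOUNDNESS: a certificate over ANY class-necessary condition set gives a SPIN-CLASS LOWER ROW.** For
`b ≤ a ≤ k` and `C` necessary for the spin class of `(a, b)` (`IsNecessaryInSpinClass a b C`: sector
conditions D, Q, G, T1, T2, T2′, … AND any rows that hold only for `Ŝ_+ψ = 0` — the `S`-row (98), the
maximal-projection rows, rank-2 nullity rows …): if `lo` lies below the energy functional `Re E_F(γ, Γ)` of
the model's exact tables on every `C`-feasible pair (what weak duality of a certified dual point of the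
`C`-constrained SDP establishes), then `SpinClassLowerRow F a b lo`, i.e. `lo ≤ E₀(H_F; a, b, S = M)`.
One line over `le_minEnergyOn_spinClass_of_forall_necessary`; the `a = b` case is
`singletLowerRow_of_forall_necessary`. [cite: Mazziotti2007RDMChapter, §II.F.1 eqs. (96)-(98)] -/
theorem spinClassLowerRow_of_forall_necessary {F : Model k} {a b : ℕ} (hba : b ≤ a) (ha : a ≤ k)
    {C : APosteriori.PairCondition k} (hC : IsNecessaryInSpinClass a b C) {lo : ℚ}
    (hlo : ∀ γ Γ, C γ Γ → ((lo : ℚ) : ℝ) ≤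
      (rdmEnergy (fun p q => (F.h p q : ℂ)) (fun p q r s => (F.eri p q r s : ℂ)) (F.ecore : ℂ)
        γ Γ).re) :
    SpinClassLowerRow F a b lo :=
  ⟨hba, ha, le_minEnergyOn_spinClass_of_forall_necessary _ _ _ hba (by simpa using ha) hC hlo⟩

/-- **READING OF A `DQGT1T2′ + F2b` CERTIFICATE** (K14-PIN-R1 ARM-B shape): if `lo` lies below the energy
functional on every sector-`DQGT1T2′`-feasible pair at `(a, b)` that ALSO satisfies the maximal-projection
rows `Σ_r G_{m,(r↓,r↑)} = 0`, then `SpinClassLowerRow F a b lo` (`b ≤ a ≤ k`). No hypothesis on the spin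
of the sector's ground state is used or produced: the row is about `E₀(H_F; a, b, S = M)`.
[cite: NakataEtAl2008, §II.A-C] -/
theorem spinClassLowerRow_of_forall_isDQGT1T2PrimeFeasibleSector_maximalProjection {F : Model k}
    {a b : ℕ} (hba : b ≤ a) (ha : a ≤ k) {lo : ℚ}
    (hlo : ∀ γ Γ, IsDQGT1T2PrimeFeasibleSector a b γ Γ →
      (∀ m : Orb (Fin k) × Orb (Fin k), ∑ r : Fin k, gMap γ Γ m (orb r 1, orb r 0) = 0) →
      ((lo : ℚ) : ℝ) ≤ (rdmEnergy (fun p q => (F.h p q : ℂ)) (fun p q r s => (F.eri p q r s : ℂ))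
        (F.ecore : ℂ) γ Γ).re) :
    SpinClassLowerRow F a b lo :=
  spinClassLowerRow_of_forall_necessary hba ha
    (isNecessaryInSpinClass_isDQGT1T2PrimeFeasibleSector_maximalProjection a b)
    fun γ Γ h => hlo γ Γ h.1 h.2

/-- **READING OF A `DQGT1T2′ + F2b + Q2` CERTIFICATE ON A DOUBLET SECTOR** (K14-PIN-R1 ARM-A shape): if
`lo` lies below the energy functional on every sector-`DQGT1T2′`-feasible pair at `(b+1, b)` that ALSO
satisfies the maximal-projection rows `Σ_r G_{m,(r↓,r↑)} = 0` and the rank-2 nullity rows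
`Γ^{pα qα}_{rα sα} + Γ^{pβ qβ}_{rβ sβ} − Γ^{pα qβ}_{rα sβ} − Γ^{pα qβ}_{rβ sα} − Γ^{pβ qα}_{rα sβ}
− Γ^{pβ qα}_{rβ sα} = 0`, then `SpinClassLowerRow F (b+1) b lo` (`b + 1 ≤ k`): `lo ≤ E₀(H_F; b+1, b,
S = ½)`. No hypothesis on the spin of the sector's ground state is used or produced (§4 says what a
certified leg in the next sector `(b+2, b−1)` up the `Ŝ_+` ladder adds). [cite: NakataEtAl2008, §II.A-C] -/
theorem spinClassLowerRow_of_forall_isDQGT1T2PrimeFeasibleSector_maximalProjection_rankTwoNullity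
    {F : Model k} {b : ℕ} (hb : b + 1 ≤ k) {lo : ℚ}
    (hlo : ∀ γ Γ, IsDQGT1T2PrimeFeasibleSector (b + 1) b γ Γ →
      (∀ m : Orb (Fin k) × Orb (Fin k), ∑ r : Fin k, gMap γ Γ m (orb r 1, orb r 0) = 0) →
      (∀ p q r s : Fin k, Γ (orb p 0, orb q 0) (orb r 0, orb s 0) + Γ (orb p 1, orb q 1) (orb r 1, orb s 1) -
        Γ (orb p 0, orb q 1) (orb r 0, orb s 1) - Γ (orb p 0, orb q 1) (orb r 1, orb s 0) -
        Γ (orb p 1, orb q 0) (orb r 0, orb s 1) - Γ (orb p 1, orb q 0) (orb r 1, orb s 0) = 0) →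
      ((lo : ℚ) : ℝ) ≤ (rdmEnergy (fun p q => (F.h p q : ℂ)) (fun p q r s => (F.eri p q r s : ℂ))
        (F.ecore : ℂ) γ Γ).re) :
    SpinClassLowerRow F (b + 1) b lo :=
  spinClassLowerRow_of_forall_necessary (Nat.le_succ b) hb
    (isNecessaryInSpinClass_isDQGT1T2PrimeFeasibleSector_maximalProjection_rankTwoNullity b)
    fun γ Γ h => hlo γ Γ h.1 h.2.1 h.2.2

section DualCone

variable {κ : Type*} [Fintype κ] {X : κ → Type*} [∀ c, Fintype (X c)]

/-- **EXACT DUAL-CONE CERTIFICATE ⇒ SPIN-CLASS LOWER ROW** (2-RDM level, arbitrary condition set, any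
sector `b ≤ a ≤ k`). A finite family of positivity maps `𝓛_c` and equality rows `A_r = b_r` necessary
for the spin class of `(a, b)`, PSD multipliers `B_c`, free multipliers `λ_r`, a constant `μ` with the
Lagrangian identity `E_F(γ, Γ) − μ = Σ_c tr(B_c 𝓛_c(γ, Γ)) + Σ_r λ_r (A_r(γ, Γ) − b_r)` for all pairs,
and `lo ≤ μ`: `SpinClassLowerRow F a b lo`. Cancès–Stoltz–Lewin eqs. (8)–(10) for one dual-feasible point
with the spin constraint «taken into account» (§2) as class-necessary rows; the `a = b` case is
`singletLowerRow_of_dualCone_certificate`. [cite: CancesStoltzLewin2006, §3 eqs. (8)-(10)] -/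
theorem spinClassLowerRow_of_dualCone_certificate [∀ c, DecidableEq (X c)] {F : Model k} {a b : ℕ}
    (hba : b ≤ a) (ha : a ≤ k)
    (L : ∀ c : κ, Matrix (Orb (Fin k)) (Orb (Fin k)) ℂ →
      Matrix (Orb (Fin k) × Orb (Fin k)) (Orb (Fin k) × Orb (Fin k)) ℂ → Matrix (X c) (X c) ℂ)
    (hL : IsNecessaryInSpinClass a b (PosMapFeasible L)) {ρ : Type*} [Fintype ρ]
    (A : ρ → Matrix (Orb (Fin k)) (Orb (Fin k)) ℂ →
      Matrix (Orb (Fin k) × Orb (Fin k)) (Orb (Fin k) × Orb (Fin k)) ℂ → ℂ) (rhs : ρ → ℂ)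
    (hArows : IsNecessaryInSpinClass a b fun γ Γ => ∀ r, A r γ Γ = rhs r)
    {B : ∀ c : κ, Matrix (X c) (X c) ℂ} (hB : ∀ c, (B c).PosSemidef) (lam : ρ → ℂ) {μ : ℝ}
    (hcert : ∀ γ Γ, rdmEnergy (fun p q => (F.h p q : ℂ)) (fun p q r s => (F.eri p q r s : ℂ))
        (F.ecore : ℂ) γ Γ - (μ : ℂ) =
      ∑ c, (B c * L c γ Γ).trace + ∑ r, lam r * (A r γ Γ - rhs r))
    {lo : ℚ} (hlo : ((lo : ℚ) : ℝ) ≤ μ) : SpinClassLowerRow F a b lo :=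
  ⟨hba, ha, hlo.trans (le_minEnergyOn_spinClass_of_dualCone_certificate _ _ _ hba (by simpa using ha)
    L hL A rhs hArows hB lam hcert)⟩

end DualCone

end Summit.Ventures.CertifiedQuantumChemistry

end
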